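import Literature.MathematicalPhysics.QuantumFieldTheory.Balaban1983to89.B9Eq349ConjugatedGreenLetters

/-!
# `Balaban1983to89.B9Eq349ConjugatedGreenLettersTwoBackgrounds` — T. Bałaban, *Propagators for lattice gauge theories in a background field*, Commun.
# Math. Phys. **99** (1985) 389–434 [Balaban1985BackgroundPropagators] (3.24)–(3.25) p. 394 with (3.49) p. 399: **THE CONJUGATED GREEN's FUNCTION OF
# `H = D†D + aQ′†Q′` AT TWO BACKGROUNDS — `‖G_κ(V) − G_κ(U)‖ ≤ (4∕γ)²·(2b_{D′} + (1+β)b_D + a(C_Q+1)(b_Q + b_{Q′}))` AND THE TWO SEAMS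
# `‖G_κ(V)Q_κ′(V) − G_κ(U)Q_κ′(U)‖`, `‖Q_κ(V)G_κ(V) − Q_κ(U)G_κ(U)‖`** — for TWO conjugated families `(D_κ, D_κ′, Q_κ, Q_κ′, H_κ, G_κ)` over two bases
# `(D_U, Q′_U)`, `(D_V, Q′_V)` with the SAME coercivity `γ`, size `C_Q` and (I4) letter `β`, and the four conjugated TWO-BACKGROUND letters
# `‖D_κ(V) − D_κ(U)‖ ≤ b_D`, `‖D_κ′(V) − D_κ′(U)‖ ≤ b_{D′}`, `‖Q_κ(V) − Q_κ(U)‖ ≤ b_Q`, `‖Q_κ′(V) − Q_κ′(U)‖ ≤ b_{Q′}` — the resolvent identity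
# `G_κ(V) − G_κ(U) = G_κ(V)(H_κ(U) − H_κ(V))G_κ(U)` AT FORM LEVEL (the `D′`-factor absorbed by `‖G_κD†‖ ≤ 4∕γ`, so NO `‖D†‖ ∼ η⁻¹` appears): the
# two-background twin of ne9-leaf-05's `B9Eq349ConjugatedGreenLetters` §2–§3 (`G_κ − G`, the seam `G_κQ_κ′ − GQ′†`)

statement-level skeleton of published theorems with citation tags; proofs where landed; nothing here is a claim about the Yang–Mills mass gap

CITATION HEADER (lean-in-tree rule 2026-08-18).  Audit cell `pub-balaban`, sub-cell `t4`, NE9 crux team (2): LEAF PROVER 01 (`b2b-balaban-t4-ne9-formalise-leaf-01`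
gen 90), I-9 = the SECOND brick of the last displayed conjugated two-background letter `δ_R` of the N52 road (α) END (ne9-leaf-04 g81's located plan (M+)
«the (PDC) chain run on DIFFERENCES with the conjugated two-background `Q′`-letters and `G′`-letters»): the `G′`-letters, ABSTRACTLY, in the letters of
ne9-leaf-05's `B9Eq349ConjugatedGreenLetters` (t4-ne9-idea-1 g84's kernel, CREDIT) — whose one-background proofs (`norm_Gk_sub_G_le`, `norm_Gk_Qk'_sub_G_adjQ_le`)
are followed term by term with the (I4) letters `β` replaced by the two-background letters `b_•`.  On the chain: `b_D`, `b_{D′}` are this lineage's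
gen-88 «conjugate the difference» letters (`B9Eq3101ConjugationLettersTwoBackgrounds(Adjoint)`, zeroth order, `∝ e^{‖κ‖ℓη}·δ`), `b_Q`, `b_{Q′}` are I-8
(`B9Eq349ConjugatedQprimeTowerTwoBackgrounds`, `∝ e^{‖κ‖ℓ′}·δ_{Q′}`); the instance is the next brick.

WHAT IS PROVED (sorry-free; 0 `def`; [folklore] finite-dimensional Hilbert-space algebra over `RCLike 𝕜`; nothing of [B9] asserted).  Letters: two bases
`D_i : S → E`, `Q′_i : S → F` (`i = 1` for `U`, `2` for `V`), coercive `γ‖f‖² ≤ ‖D_if‖² + a‖Q′_if‖²` (`0 < γ ≤ 1`, `0 ≤ a`), `‖Q′_i‖ ≤ C_Q`; two conjugated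
families `D_{κ,i}, D′_{κ,i}, Q_{κ,i}, Q′_{κ,i}` within `β` of `D_i, D_i†, Q′_i, Q′_i†` (`0 ≤ β ≤ 1`, window `3(1+a)β² ≤ γ∕4`), `H_{κ,i} = D′_{κ,i}D_{κ,i} +
aQ′_{κ,i}Q_{κ,i}` with `H_{κ,1}G_{κ,1} = 1` and `G_{κ,2}H_{κ,2} = 1 = H_{κ,2}G_{κ,2}`; the two-background letters `b_D, b_{D′}, b_Q, b_{Q′} ≥ 0`.
* §1 **`norm_Gk_sub_Gk_le`** — `‖G_{κ,2}v − G_{κ,1}v‖ ≤ (4∕γ)²·(2b_{D′} + (1+β)b_D + a(C_Q+1)(b_Q + b_{Q′}))·‖v‖`.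
* §2 **`norm_Gk_Qk'_sub_Gk_Qk'_le`** — the generator seam `‖G_{κ,2}(Q′_{κ,2}g) − G_{κ,1}(Q′_{κ,1}g)‖ ≤ ((4∕γ)b_{Q′} + (C_Q+1)(4∕γ)²(…))‖g‖`;
  **`norm_Qk_Gk_sub_Qk_Gk_le`** — the adjoint-side seam `‖Q_{κ,2}(G_{κ,2}x) − Q_{κ,1}(G_{κ,1}x)‖ ≤ (b_Q(4∕γ) + (C_Q+1)(4∕γ)²(…))‖x‖`.
HONEST SCOPE.  Symbolic: no lattice, no multiplier, no window in `κ`, no number; ONE brick of a located plan; NOT NE9; «NE9 ⇐ the named binders»; NE9 NOT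
PRINTED ∕ NOT PROVED; NOT summit progress (cell pub-balaban: row NE9 WALLED ON A MODEL (O-NE9-1; #5 UNRULED); spine PROVED 0∕9; rung (B)+1 finite T⁴ — NOT
infinite volume, NOT mass gap, NOT BetaPertH, NOT Clay; HONEST DEPENDENCY: continuum YM on T⁴ ⇐ BetaPertH ∧ nine spine estimates (0/9 proved); BetaPertH ⇐ (D1)
∧ (D4) ∧ CAP+tail; G-an2-4 gates asym, D1 and NE2/3/4).  NEW file importing `B9Eq349ConjugatedGreenLetters` only; nothing modified.  Net new unproved facts: 0.
-/

namespace Literature.MathematicalPhysics.QuantumFieldTheory.Balaban1983to89.B9Eq349ConjugatedGreenLettersTwoBackgrounds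

open scoped InnerProductSpace
open B9Eq349ConjugatedGreenLetters (norm_Gk_le norm_Dk_Gk_le norm_Gk_adjD_le norm_Qk_le norm_Qk'_le)

variable {𝕜 : Type*} [RCLike 𝕜]
variable {S E F : Type*} [NormedAddCommGroup S] [InnerProductSpace 𝕜 S] [NormedAddCommGroup E] [InnerProductSpace 𝕜 E]
  [NormedAddCommGroup F] [InnerProductSpace 𝕜 F] [FiniteDimensional 𝕜 S] [FiniteDimensional 𝕜 E] [FiniteDimensional 𝕜 F]

variable (D₁ D₂ : S →ₗ[𝕜] E) (Q₁ Q₂ : S →ₗ[𝕜] F) (a γ CQ β : ℝ)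
  (Dk₁ Dk₂ : S →ₗ[𝕜] E) (Dk₁' Dk₂' : E →ₗ[𝕜] S) (Qk₁ Qk₂ : S →ₗ[𝕜] F) (Qk₁' Qk₂' : F →ₗ[𝕜] S) (Hk₁ Hk₂ Gk₁ Gk₂ : S →ₗ[𝕜] S)
  (ha : 0 ≤ a) (hγ : 0 < γ) (hγ1 : γ ≤ 1) (hCQ : 0 ≤ CQ) (hβ : 0 ≤ β) (hβ1 : β ≤ 1)
  (coercive₁ : ∀ f, γ * ‖f‖ ^ 2 ≤ ‖D₁ f‖ ^ 2 + a * ‖Q₁ f‖ ^ 2) (coercive₂ : ∀ f, γ * ‖f‖ ^ 2 ≤ ‖D₂ f‖ ^ 2 + a * ‖Q₂ f‖ ^ 2)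
  (hQ₁ : ∀ s, ‖Q₁ s‖ ≤ CQ * ‖s‖) (hQ₂ : ∀ s, ‖Q₂ s‖ ≤ CQ * ‖s‖)
  (dD₁ : ∀ s, ‖Dk₁ s - D₁ s‖ ≤ β * ‖s‖) (dD₁' : ∀ e, ‖Dk₁' e - LinearMap.adjoint D₁ e‖ ≤ β * ‖e‖)
  (dQ₁ : ∀ s, ‖Qk₁ s - Q₁ s‖ ≤ β * ‖s‖) (dQ₁' : ∀ g, ‖Qk₁' g - LinearMap.adjoint Q₁ g‖ ≤ β * ‖g‖)
  (dD₂ : ∀ s, ‖Dk₂ s - D₂ s‖ ≤ β * ‖s‖) (dD₂' : ∀ e, ‖Dk₂' e - LinearMap.adjoint D₂ e‖ ≤ β * ‖e‖)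
  (dQ₂ : ∀ s, ‖Qk₂ s - Q₂ s‖ ≤ β * ‖s‖) (dQ₂' : ∀ g, ‖Qk₂' g - LinearMap.adjoint Q₂ g‖ ≤ β * ‖g‖)
  (small : 3 * (1 + a) * β ^ 2 ≤ γ / 4)
  (hHk₁ : ∀ f, Hk₁ f = Dk₁' (Dk₁ f) + ((a : ℝ) : 𝕜) • Qk₁' (Qk₁ f)) (hHkGk₁ : ∀ v, Hk₁ (Gk₁ v) = v)
  (hHk₂ : ∀ f, Hk₂ f = Dk₂' (Dk₂ f) + ((a : ℝ) : 𝕜) • Qk₂' (Qk₂ f)) (hHkGk₂ : ∀ v, Hk₂ (Gk₂ v) = v) (hGkHk₂ : ∀ s, Gk₂ (Hk₂ s) = s)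
  -- the four conjugated TWO-BACKGROUND letters
  {bD bD' bQ bQ' : ℝ} (hbD : 0 ≤ bD) (hbD' : 0 ≤ bD') (hbQ : 0 ≤ bQ) (hbQ' : 0 ≤ bQ')
  (tD : ∀ s, ‖Dk₂ s - Dk₁ s‖ ≤ bD * ‖s‖) (tD' : ∀ e, ‖Dk₂' e - Dk₁' e‖ ≤ bD' * ‖e‖)
  (tQ : ∀ s, ‖Qk₂ s - Qk₁ s‖ ≤ bQ * ‖s‖) (tQ' : ∀ g, ‖Qk₂' g - Qk₁' g‖ ≤ bQ' * ‖g‖)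

omit [FiniteDimensional 𝕜 S] [FiniteDimensional 𝕜 E] [FiniteDimensional 𝕜 F] in
/-- Chaining two linear bounds. [folklore] -/
private theorem le_chain' {p q r A B : ℝ} (h1 : p ≤ A * q) (h2 : q ≤ B * r) (hA : 0 ≤ A) : p ≤ A * B * r :=
  calc p ≤ A * q := h1
    _ ≤ A * (B * r) := mul_le_mul_of_nonneg_left h2 hA
    _ = A * B * r := by ring

/-! ## §1 The resolvent identity at two backgrounds: `G_κ(V) − G_κ(U) = G_κ(V)(H_κ(U) − H_κ(V))G_κ(U)` -/

include ha hγ hγ1 hCQ hβ hβ1 coercive₁ coercive₂ hQ₁ hQ₂ dD₁ dD₁' dQ₁ dQ₁' dD₂ dD₂' dQ₂ dQ₂' small hHk₁ hHkGk₁ hHk₂ hHkGk₂ hGkHk₂ hbD hbD' hbQ hbQ'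
  tD tD' tQ tQ' in
/-- **THE CONJUGATED GREEN's FUNCTIONS OF TWO BACKGROUNDS**: `‖G_{κ,2}v − G_{κ,1}v‖ ≤ (4∕γ)²·(2b_{D′} + (1+β)b_D + a(C_Q+1)(b_Q + b_{Q′}))·‖v‖` —
`G_{κ,2} − G_{κ,1} = G_{κ,2}(H_{κ,1} − H_{κ,2})G_{κ,1}`, `H_{κ,1} − H_{κ,2} = (D′_{κ,1} − D′_{κ,2})D_{κ,1} + D′_{κ,2}(D_{κ,1} − D_{κ,2}) + a(…)`, the four
terms through `‖G_{κ,2}‖ ≤ 4∕γ`, `‖D_{κ,1}G_{κ,1}‖ ≤ 8∕γ`, `‖G_{κ,2}D_2†‖ ≤ 4∕γ` (+ `β` for `D′_{κ,2} − D_2†`), `‖Q_{κ,1}‖, ‖Q′_{κ,2}‖ ≤ C_Q + 1` —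
AT FORM LEVEL, no `‖D†‖`. [folklore] [cite: Balaban1985BackgroundPropagators, (3.24)–(3.25) p.394, (3.49) p.399] -/
theorem norm_Gk_sub_Gk_le (v : S) :
    ‖Gk₂ v - Gk₁ v‖ ≤ (4 / γ) ^ 2 * (2 * bD' + (1 + β) * bD + a * (CQ + 1) * (bQ + bQ')) * ‖v‖ := by
  have key : Gk₂ v - Gk₁ v =
      Gk₂ (Dk₁' (Dk₁ (Gk₁ v)) - Dk₂' (Dk₁ (Gk₁ v))) + Gk₂ (Dk₂' (Dk₁ (Gk₁ v) - Dk₂ (Gk₁ v))) +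
        ((a : ℝ) : 𝕜) • (Gk₂ (Qk₁' (Qk₁ (Gk₁ v)) - Qk₂' (Qk₁ (Gk₁ v))) + Gk₂ (Qk₂' (Qk₁ (Gk₁ v) - Qk₂ (Gk₁ v)))) := by
    have : Gk₂ v - Gk₁ v = Gk₂ (Hk₁ (Gk₁ v)) - Gk₂ (Hk₂ (Gk₁ v)) := by rw [hHkGk₁, hGkHk₂]
    rw [this, hHk₁, hHk₂]; simp only [map_sub, map_add, map_smul, smul_sub, smul_add]; abel
  have hc0 : (0 : ℝ) ≤ 4 / γ := by positivity
  -- the sizes at background 1: `‖G₁v‖ ≤ (4∕γ)‖v‖`, `‖D_{κ,1}G₁v‖ ≤ (8∕γ)‖v‖`, `‖Q_{κ,1}‖ ≤ C_Q + 1`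
  have nG₁ : ‖Gk₁ v‖ ≤ 4 / γ * ‖v‖ :=
    norm_Gk_le D₁ Q₁ a γ β Dk₁ Dk₁' Qk₁ Qk₁' Hk₁ Gk₁ ha hγ hβ coercive₁ dD₁ dD₁' dQ₁ dQ₁' small hHk₁ hHkGk₁ v
  have nDG₁ : ‖Dk₁ (Gk₁ v)‖ ≤ 2 * (4 / γ) * ‖v‖ :=
    norm_Dk_Gk_le D₁ Q₁ a γ β Dk₁ Dk₁' Qk₁ Qk₁' Hk₁ Gk₁ ha hγ hγ1 hβ hβ1 coercive₁ dD₁ dD₁' dQ₁ dQ₁' small hHk₁ hHkGk₁ v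
  have nQG₁ : ‖Qk₁ (Gk₁ v)‖ ≤ (CQ + 1) * (4 / γ * ‖v‖) :=
    (norm_Qk_le Q₁ CQ β Qk₁ hβ1 hQ₁ dQ₁ _).trans (mul_le_mul_of_nonneg_left nG₁ (by linarith))
  -- the sizes at background 2: `‖G₂‖ ≤ 4∕γ`, `‖G₂D_2†‖ ≤ 4∕γ`, `‖Q′_{κ,2}‖ ≤ C_Q + 1`
  have nG₂ := norm_Gk_le D₂ Q₂ a γ β Dk₂ Dk₂' Qk₂ Qk₂' Hk₂ Gk₂ ha hγ hβ coercive₂ dD₂ dD₂' dQ₂ dQ₂' small hHk₂ hHkGk₂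
  have nGD₂ := norm_Gk_adjD_le D₂ Q₂ a γ β Dk₂ Dk₂' Qk₂ Qk₂' Hk₂ Gk₂ ha hγ hγ1 hβ coercive₂ dD₂ dD₂' dQ₂ dQ₂' small hHk₂ hHkGk₂
  have nQ'₂ := norm_Qk'_le Q₂ CQ β Qk₂' hCQ hβ1 hQ₂ dQ₂'
  -- four terms
  have t1 : ‖Gk₂ (Dk₁' (Dk₁ (Gk₁ v)) - Dk₂' (Dk₁ (Gk₁ v)))‖ ≤ 4 / γ * bD' * (2 * (4 / γ) * ‖v‖) := by
    refine le_chain' (nG₂ _) ?_ hc0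
    rw [norm_sub_rev]; exact (tD' _).trans (mul_le_mul_of_nonneg_left nDG₁ hbD')
  have t2 : ‖Gk₂ (Dk₂' (Dk₁ (Gk₁ v) - Dk₂ (Gk₁ v)))‖ ≤ 4 / γ * (1 + β) * (bD * (4 / γ * ‖v‖)) := by
    set w := Dk₁ (Gk₁ v) - Dk₂ (Gk₁ v) with hw
    have nw : ‖w‖ ≤ bD * (4 / γ * ‖v‖) := by
      rw [hw, norm_sub_rev]; exact (tD _).trans (mul_le_mul_of_nonneg_left nG₁ hbD)
    have e : Gk₂ (Dk₂' w) = Gk₂ (Dk₂' w - LinearMap.adjoint D₂ w) + Gk₂ (LinearMap.adjoint D₂ w) := by rw [← map_add, sub_add_cancel]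
    calc ‖Gk₂ (Dk₂' w)‖ ≤ ‖Gk₂ (Dk₂' w - LinearMap.adjoint D₂ w)‖ + ‖Gk₂ (LinearMap.adjoint D₂ w)‖ := by rw [e]; exact norm_add_le _ _
      _ ≤ 4 / γ * (β * ‖w‖) + 4 / γ * ‖w‖ := add_le_add ((nG₂ _).trans (mul_le_mul_of_nonneg_left (dD₂' w) hc0)) (nGD₂ w)
      _ = 4 / γ * (1 + β) * ‖w‖ := by ring
      _ ≤ 4 / γ * (1 + β) * (bD * (4 / γ * ‖v‖)) := mul_le_mul_of_nonneg_left nw (by positivity)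
  have t3 : ‖Gk₂ (Qk₁' (Qk₁ (Gk₁ v)) - Qk₂' (Qk₁ (Gk₁ v)))‖ ≤ 4 / γ * bQ' * ((CQ + 1) * (4 / γ * ‖v‖)) := by
    refine le_chain' (nG₂ _) ?_ hc0
    rw [norm_sub_rev]; exact (tQ' _).trans (mul_le_mul_of_nonneg_left nQG₁ hbQ')
  have t4 : ‖Gk₂ (Qk₂' (Qk₁ (Gk₁ v) - Qk₂ (Gk₁ v)))‖ ≤ 4 / γ * (CQ + 1) * (bQ * (4 / γ * ‖v‖)) := by
    refine le_chain' (nG₂ _) ((nQ'₂ _).trans (mul_le_mul_of_nonneg_left ?_ (by linarith))) hc0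
    rw [norm_sub_rev]; exact (tQ _).trans (mul_le_mul_of_nonneg_left nG₁ hbQ)
  have na : ‖((a : ℝ) : 𝕜)‖ = a := by rw [RCLike.norm_ofReal, abs_of_nonneg ha]
  calc ‖Gk₂ v - Gk₁ v‖ = _ := by rw [key]
    _ ≤ ‖Gk₂ (Dk₁' (Dk₁ (Gk₁ v)) - Dk₂' (Dk₁ (Gk₁ v)))‖ + ‖Gk₂ (Dk₂' (Dk₁ (Gk₁ v) - Dk₂ (Gk₁ v)))‖
        + a * (‖Gk₂ (Qk₁' (Qk₁ (Gk₁ v)) - Qk₂' (Qk₁ (Gk₁ v)))‖ + ‖Gk₂ (Qk₂' (Qk₁ (Gk₁ v) - Qk₂ (Gk₁ v)))‖) := by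
        refine (norm_add_le _ _).trans (add_le_add (norm_add_le _ _) ?_)
        rw [norm_smul, na]; exact mul_le_mul_of_nonneg_left (norm_add_le _ _) ha
    _ ≤ 4 / γ * bD' * (2 * (4 / γ) * ‖v‖) + 4 / γ * (1 + β) * (bD * (4 / γ * ‖v‖))
        + a * (4 / γ * bQ' * ((CQ + 1) * (4 / γ * ‖v‖)) + 4 / γ * (CQ + 1) * (bQ * (4 / γ * ‖v‖))) := by
        gcongr
    _ = (4 / γ) ^ 2 * (2 * bD' + (1 + β) * bD + a * (CQ + 1) * (bQ + bQ')) * ‖v‖ := by ring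

/-! ## §2 The two seams: the generator `A_κ = G_κQ′_κ` and its adjoint side `Q_κG_κ` at two backgrounds -/

include ha hγ hγ1 hCQ hβ hβ1 coercive₁ coercive₂ hQ₁ hQ₂ dD₁ dD₁' dQ₁ dQ₁' dD₂ dD₂' dQ₂ dQ₂' small hHk₁ hHkGk₁ hHk₂ hHkGk₂ hGkHk₂ hbD hbD' hbQ hbQ'
  tD tD' tQ tQ' in
/-- **THE GENERATOR SEAM AT TWO BACKGROUNDS**: `‖G_{κ,2}(Q′_{κ,2}g) − G_{κ,1}(Q′_{κ,1}g)‖ ≤ ((4∕γ)·b_{Q′} + (4∕γ)²(2b_{D′} + (1+β)b_D + a(C_Q+1)(b_Q + b_{Q′}))·(C_Q + 1))·‖g‖`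
— `A_{κ,2} − A_{κ,1} = G_{κ,2}(Q′_{κ,2} − Q′_{κ,1}) + (G_{κ,2} − G_{κ,1})Q′_{κ,1}`. [folklore]
[cite: Balaban1985BackgroundPropagators, (3.24)–(3.25) p.394, (3.49) p.399] -/
theorem norm_Gk_Qk'_sub_Gk_Qk'_le (g : F) :
    ‖Gk₂ (Qk₂' g) - Gk₁ (Qk₁' g)‖ ≤
      (4 / γ * bQ' + (4 / γ) ^ 2 * (2 * bD' + (1 + β) * bD + a * (CQ + 1) * (bQ + bQ')) * (CQ + 1)) * ‖g‖ := by
  have e : Gk₂ (Qk₂' g) - Gk₁ (Qk₁' g) = Gk₂ (Qk₂' g - Qk₁' g) + (Gk₂ (Qk₁' g) - Gk₁ (Qk₁' g)) := by rw [map_sub]; abel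
  have t1 : ‖Gk₂ (Qk₂' g - Qk₁' g)‖ ≤ 4 / γ * (bQ' * ‖g‖) :=
    (norm_Gk_le D₂ Q₂ a γ β Dk₂ Dk₂' Qk₂ Qk₂' Hk₂ Gk₂ ha hγ hβ coercive₂ dD₂ dD₂' dQ₂ dQ₂' small hHk₂ hHkGk₂ _).trans
      (mul_le_mul_of_nonneg_left (tQ' g) (by positivity))
  have t2 : ‖Gk₂ (Qk₁' g) - Gk₁ (Qk₁' g)‖ ≤ (4 / γ) ^ 2 * (2 * bD' + (1 + β) * bD + a * (CQ + 1) * (bQ + bQ')) * ((CQ + 1) * ‖g‖) :=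
    (norm_Gk_sub_Gk_le D₁ D₂ Q₁ Q₂ a γ CQ β Dk₁ Dk₂ Dk₁' Dk₂' Qk₁ Qk₂ Qk₁' Qk₂' Hk₁ Hk₂ Gk₁ Gk₂ ha hγ hγ1 hCQ hβ hβ1 coercive₁ coercive₂ hQ₁ hQ₂
        dD₁ dD₁' dQ₁ dQ₁' dD₂ dD₂' dQ₂ dQ₂' small hHk₁ hHkGk₁ hHk₂ hHkGk₂ hGkHk₂ hbD hbD' hbQ hbQ' tD tD' tQ tQ' _).trans
      (mul_le_mul_of_nonneg_left (norm_Qk'_le Q₁ CQ β Qk₁' hCQ hβ1 hQ₁ dQ₁' g) (by positivity))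
  calc ‖Gk₂ (Qk₂' g) - Gk₁ (Qk₁' g)‖ ≤ ‖Gk₂ (Qk₂' g - Qk₁' g)‖ + ‖Gk₂ (Qk₁' g) - Gk₁ (Qk₁' g)‖ := by rw [e]; exact norm_add_le _ _
    _ ≤ 4 / γ * (bQ' * ‖g‖) + (4 / γ) ^ 2 * (2 * bD' + (1 + β) * bD + a * (CQ + 1) * (bQ + bQ')) * ((CQ + 1) * ‖g‖) := add_le_add t1 t2
    _ = _ := by ring

include ha hγ hγ1 hCQ hβ hβ1 coercive₁ coercive₂ hQ₁ hQ₂ dD₁ dD₁' dQ₁ dQ₁' dD₂ dD₂' dQ₂ dQ₂' small hHk₁ hHkGk₁ hHk₂ hHkGk₂ hGkHk₂ hbD hbD' hbQ hbQ'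
  tD tD' tQ tQ' in
/-- **THE ADJOINT-SIDE SEAM AT TWO BACKGROUNDS**: `‖Q_{κ,2}(G_{κ,2}x) − Q_{κ,1}(G_{κ,1}x)‖ ≤ (b_Q·(4∕γ) + (C_Q + 1)·(4∕γ)²(2b_{D′} + (1+β)b_D + a(C_Q+1)(b_Q + b_{Q′})))·‖x‖`
— `Q_{κ,2}G_{κ,2} − Q_{κ,1}G_{κ,1} = (Q_{κ,2} − Q_{κ,1})G_{κ,2} + Q_{κ,1}(G_{κ,2} − G_{κ,1})`. [folklore]
[cite: Balaban1985BackgroundPropagators, (3.24)–(3.25) p.394, (3.49) p.399] -/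
theorem norm_Qk_Gk_sub_Qk_Gk_le (x : S) :
    ‖Qk₂ (Gk₂ x) - Qk₁ (Gk₁ x)‖ ≤
      (bQ * (4 / γ) + (CQ + 1) * ((4 / γ) ^ 2 * (2 * bD' + (1 + β) * bD + a * (CQ + 1) * (bQ + bQ')))) * ‖x‖ := by
  have e : Qk₂ (Gk₂ x) - Qk₁ (Gk₁ x) = (Qk₂ (Gk₂ x) - Qk₁ (Gk₂ x)) + Qk₁ (Gk₂ x - Gk₁ x) := by rw [map_sub]; abel
  have t1 : ‖Qk₂ (Gk₂ x) - Qk₁ (Gk₂ x)‖ ≤ bQ * (4 / γ * ‖x‖) :=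
    (tQ _).trans (mul_le_mul_of_nonneg_left
      (norm_Gk_le D₂ Q₂ a γ β Dk₂ Dk₂' Qk₂ Qk₂' Hk₂ Gk₂ ha hγ hβ coercive₂ dD₂ dD₂' dQ₂ dQ₂' small hHk₂ hHkGk₂ x) hbQ)
  have t2 : ‖Qk₁ (Gk₂ x - Gk₁ x)‖ ≤ (CQ + 1) * ((4 / γ) ^ 2 * (2 * bD' + (1 + β) * bD + a * (CQ + 1) * (bQ + bQ')) * ‖x‖) :=
    (norm_Qk_le Q₁ CQ β Qk₁ hβ1 hQ₁ dQ₁ _).trans (mul_le_mul_of_nonneg_left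
      (norm_Gk_sub_Gk_le D₁ D₂ Q₁ Q₂ a γ CQ β Dk₁ Dk₂ Dk₁' Dk₂' Qk₁ Qk₂ Qk₁' Qk₂' Hk₁ Hk₂ Gk₁ Gk₂ ha hγ hγ1 hCQ hβ hβ1 coercive₁ coercive₂ hQ₁ hQ₂
        dD₁ dD₁' dQ₁ dQ₁' dD₂ dD₂' dQ₂ dQ₂' small hHk₁ hHkGk₁ hHk₂ hHkGk₂ hGkHk₂ hbD hbD' hbQ hbQ' tD tD' tQ tQ' x) (by linarith))
  calc ‖Qk₂ (Gk₂ x) - Qk₁ (Gk₁ x)‖ ≤ ‖Qk₂ (Gk₂ x) - Qk₁ (Gk₂ x)‖ + ‖Qk₁ (Gk₂ x - Gk₁ x)‖ := by rw [e]; exact norm_add_le _ _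
    _ ≤ bQ * (4 / γ * ‖x‖) + (CQ + 1) * ((4 / γ) ^ 2 * (2 * bD' + (1 + β) * bD + a * (CQ + 1) * (bQ + bQ')) * ‖x‖) := add_le_add t1 t2
    _ = _ := by ring

end Literature.MathematicalPhysics.QuantumFieldTheory.Balaban1983to89.B9Eq349ConjugatedGreenLettersTwoBackgrounds
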